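import Mathlib.Data.Nat.Basic
import Mathlib.Data.Finset.Card
import Mathlib.Data.Finset.Basic
import Mathlib.Algebra.Order.Group.Nat
import Mathlib.Algebra.Order.Ring.Defs
import Mathlib.Tactic.Ring
import Mathlib.Tactic.Linarith
import HarnessLib

/-!
# Rearrangeable permutation networks (Beneš 1964 / Waksman 1968)

Literature / complexity toolkit (serves the quasi-linear succinct Cook–Levin reduction behind
Williams' Fact 3.1, `SuccinctSkeletonReductions.lean`, leaf `Williams2014_fact_3_1_skeleton`:
a nondeterministically switched permutation network brings every `pop` of a stack transcript
next to its matching `push`, so that the consistency of `2ⁿ` stack operations is expressed by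
`2ⁿ · poly(n)` LOCAL constraints along a FIXED, index-computable wiring pattern; cf. the
sorting-network consistency checks of Gurevich–Shelah 1989 and Robson 1991 cited by
Fortnow–Lipton–van Melkebeek–Viglas 2005, §3.1).

The network on the positions `0, …, 2ᵏ - 1` has `2k` layers; layer `ℓ` has *dimension*
`(dims k)[ℓ]`, `dims k = [0, 1, …, k-1, k-1, …, 1, 0]` (a butterfly followed by its mirror
image — the Beneš network with its middle dimension repeated, which only adds freedom), and
consists of the `2ᵏ⁻¹` switches `{p, flipBit d p}` (positions differing exactly in bit `d`),
each straight or crossed according to a switch bit read at the smaller position `base d p`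
of the pair.

* `flipBit d p`, `base d p` — partner and switch address, by arithmetic on bit `d`
  (`(p / 2ᵈ) % 2`): involutivity, ranges, and the shift identities
  (`flipBit (d+1) p = 2 · flipBit d (p/2) + p % 2`) that split a network whose dimensions are
  all positive into its even and odd halves (`run_map_succ`);
* `layer d s`, `run ds sw` — the position map of one layer with switch setting `s`, and of the
  network with dimension list `ds` and settings `sw ℓ`, layer by layer; `run` maps `[0, 2ᵏ)`
  to itself injectively (`run_lt`, `run_injOn`), hence onto (`exists_run_eq`);
* `exists_twoColoring` — the routing lemma ("looping algorithm"): two fixed-point-free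
  involutions of a finite set admit a `2`-colouring that is bichromatic for both;
* **`exists_switches`** — rearrangeability (Beneš 1964; Waksman 1968): every bijection of
  `[0, 2ᵏ)` is the position map `run (dims k) sw` of some switch setting `sw`.

## References

* V. E. Beneš, *Permutation groups, complexes, and rearrangeable connecting networks*, Bell
  System Tech. J. 43 (1964) 1619–1640 (the network made of two half-size networks between an
  input and an output stage of `2 × 2` switches is rearrangeable).
* A. Waksman, *A permutation network*, J. ACM 15 (1968) 159–163, §2 (recursive construction;
  routing by alternating between input-switch and output-switch constraints).
* L. Fortnow, R. Lipton, D. van Melkebeek, A. Viglas, *Time-space lower bounds for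
  satisfiability*, J. ACM 52 (2005) 835–865, §3.1 [FortnowEtAl2005].
-/

namespace Literature.Computability.Complexity

namespace Benes

/-! ### Bit `d` by arithmetic -/

/-- The partner of position `p` across dimension `d`: `p` with bit `d` flipped, i.e. `p ∓ 2ᵈ`
according to the parity of `p / 2ᵈ`. [folklore] -/
def flipBit (d p : ℕ) : ℕ := if p / 2 ^ d % 2 = 1 then p - 2 ^ d else p + 2 ^ d

/-- The switch address of position `p` in a layer of dimension `d`: `p` with bit `d` cleared,
the smaller element of the pair `{p, flipBit d p}`. [folklore] -/
def base (d p : ℕ) : ℕ := if p / 2 ^ d % 2 = 1 then p - 2 ^ d else p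

/-- If bit `d` of `p` is set then `2ᵈ ≤ p`. [folklore] -/
theorem two_pow_le_of_odd {d p : ℕ} (h : p / 2 ^ d % 2 = 1) : 2 ^ d ≤ p := by
  by_contra hlt
  rw [Nat.div_eq_of_lt (Nat.lt_of_not_le hlt)] at h
  simp at h

/-- `2ᵈ ≤ 2ᵈ · (p / 2ᵈ)` when bit `d` of `p` is set. [folklore] -/
theorem two_pow_le_mul_div_of_odd {d p : ℕ} (h : p / 2 ^ d % 2 = 1) :
    2 ^ d ≤ 2 ^ d * (p / 2 ^ d) := by
  refine Nat.le_mul_of_pos_right _ (Nat.pos_of_ne_zero fun h0 => ?_)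
  rw [h0] at h; simp at h

/-- Quotient and remainder of a number written as `2ᵈ · m + r`, `r < 2ᵈ`. [folklore] -/
theorem div_of_decomp {d m r : ℕ} (hr : r < 2 ^ d) : (2 ^ d * m + r) / 2 ^ d = m := by
  rw [Nat.mul_add_div (Nat.two_pow_pos d), Nat.div_eq_of_lt hr, Nat.add_zero]

/-- `flipBit` in quotient/remainder form. [folklore] -/
theorem flipBit_eq (d p : ℕ) : flipBit d p =
    2 ^ d * (if p / 2 ^ d % 2 = 1 then p / 2 ^ d - 1 else p / 2 ^ d + 1) + p % 2 ^ d := by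
  have hp : 2 ^ d * (p / 2 ^ d) + p % 2 ^ d = p := Nat.div_add_mod p (2 ^ d)
  unfold flipBit
  split_ifs with h
  · have hle := two_pow_le_mul_div_of_odd h
    rw [Nat.mul_sub, Nat.mul_one]
    omega
  · rw [Nat.mul_add, Nat.mul_one]
    omega

/-- `base` in quotient/remainder form. [folklore] -/
theorem base_eq (d p : ℕ) : base d p = 2 ^ d * (p / 2 ^ d - p / 2 ^ d % 2) + p % 2 ^ d := by
  have hp : 2 ^ d * (p / 2 ^ d) + p % 2 ^ d = p := Nat.div_add_mod p (2 ^ d)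
  unfold base
  split_ifs with h
  · have hle := two_pow_le_mul_div_of_odd h
    rw [h, Nat.mul_sub, Nat.mul_one]
    omega
  · have h0 : p / 2 ^ d % 2 = 0 := by have := Nat.mod_two_eq_zero_or_one (p / 2 ^ d); omega
    rw [h0, Nat.sub_zero]
    omega

/-- The quotient of `flipBit d p` by `2ᵈ`. [folklore] -/
theorem div_flipBit (d p : ℕ) :
    flipBit d p / 2 ^ d = if p / 2 ^ d % 2 = 1 then p / 2 ^ d - 1 else p / 2 ^ d + 1 := by
  rw [flipBit_eq, div_of_decomp (Nat.mod_lt p (Nat.two_pow_pos d))]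

/-- The remainder of `flipBit d p` modulo `2ᵈ` is that of `p`. [folklore] -/
theorem mod_flipBit (d p : ℕ) : flipBit d p % 2 ^ d = p % 2 ^ d := by
  rw [flipBit_eq, Nat.mul_add_mod, Nat.mod_mod]

/-- Flipping bit `d` changes the parity of the quotient by `2ᵈ`. [folklore] -/
theorem div_flipBit_mod_two (d p : ℕ) : flipBit d p / 2 ^ d % 2 = 1 - p / 2 ^ d % 2 := by
  rw [div_flipBit]
  have := Nat.mod_two_eq_zero_or_one (p / 2 ^ d)
  split_ifs with h <;> omega

/-- `flipBit d` is an involution. [folklore] -/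
@[simp] theorem flipBit_flipBit (d p : ℕ) : flipBit d (flipBit d p) = p := by
  have h1 : flipBit d (flipBit d p) / 2 ^ d = p / 2 ^ d := by
    rw [div_flipBit, div_flipBit_mod_two, div_flipBit]
    rcases Nat.mod_two_eq_zero_or_one (p / 2 ^ d) with h | h
    · simp [h]
    · have h1' : 1 ≤ p / 2 ^ d := Nat.pos_of_ne_zero fun h0 => by rw [h0] at h; simp at h
      simp only [h, Nat.sub_self, zero_ne_one, if_false, if_true]
      exact Nat.sub_add_cancel h1'
  have h2 : flipBit d (flipBit d p) % 2 ^ d = p % 2 ^ d := by rw [mod_flipBit, mod_flipBit]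
  rw [← Nat.div_add_mod (flipBit d (flipBit d p)) (2 ^ d), h1, h2, Nat.div_add_mod]

/-- `flipBit d p ≠ p`. [folklore] -/
theorem flipBit_ne (d p : ℕ) : flipBit d p ≠ p := by
  intro h
  have h1 := div_flipBit_mod_two d p
  rw [h] at h1
  have := Nat.mod_two_eq_zero_or_one (p / 2 ^ d)
  omega

/-- The two positions of a switch have the same address. [folklore] -/
@[simp] theorem base_flipBit (d p : ℕ) : base d (flipBit d p) = base d p := by
  rw [base_eq, base_eq, div_flipBit_mod_two, mod_flipBit, div_flipBit]
  have := Nat.mod_two_eq_zero_or_one (p / 2 ^ d)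
  split_ifs with h
  · congr 2; omega
  · congr 2; omega

/-- `base d p ≤ p`. [folklore] -/
theorem base_le (d p : ℕ) : base d p ≤ p := by
  unfold base; split_ifs
  · exact Nat.sub_le p _
  · exact le_rfl

/-- Flipping bit `d < k` keeps a position below `2ᵏ`. [folklore] -/
theorem flipBit_lt {k d p : ℕ} (hd : d < k) (hp : p < 2 ^ k) : flipBit d p < 2 ^ k := by
  rw [flipBit_eq]
  have hr := Nat.mod_lt p (Nat.two_pow_pos d)
  have hpk : 2 ^ k = 2 ^ d * 2 ^ (k - d) := by rw [← Nat.pow_add]; congr 1; omega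
  have hq : p / 2 ^ d < 2 ^ (k - d) := by
    rw [Nat.div_lt_iff_lt_mul (Nat.two_pow_pos d), Nat.mul_comm, ← hpk]; exact hp
  have heven : 2 ^ (k - d) % 2 = 0 := by
    obtain ⟨j, hj⟩ : ∃ j, k - d = j + 1 := ⟨k - d - 1, by omega⟩
    rw [hj, Nat.pow_succ]; simp
  have := Nat.mod_two_eq_zero_or_one (p / 2 ^ d)
  split_ifs with h
  · calc 2 ^ d * (p / 2 ^ d - 1) + p % 2 ^ d < 2 ^ d * (p / 2 ^ d - 1) + 2 ^ d := by omega
      _ = 2 ^ d * (p / 2 ^ d - 1 + 1) := by ring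
      _ ≤ 2 ^ d * 2 ^ (k - d) := Nat.mul_le_mul_left _ (by
          have h1' : 1 ≤ p / 2 ^ d := Nat.pos_of_ne_zero fun h0 => by rw [h0] at h; simp at h
          rw [Nat.sub_add_cancel h1']; exact hq.le)
      _ = 2 ^ k := hpk.symm
  · have hq0 : p / 2 ^ d % 2 = 0 := by omega
    have e1 := Nat.div_add_mod (p / 2 ^ d) 2
    have e2 := Nat.div_add_mod (2 ^ (k - d)) 2
    have hq2 : p / 2 ^ d + 2 ≤ 2 ^ (k - d) := by omega
    calc 2 ^ d * (p / 2 ^ d + 1) + p % 2 ^ d < 2 ^ d * (p / 2 ^ d + 1) + 2 ^ d := by omega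
      _ = 2 ^ d * (p / 2 ^ d + 2) := by ring
      _ ≤ 2 ^ d * 2 ^ (k - d) := Nat.mul_le_mul_left _ hq2
      _ = 2 ^ k := hpk.symm

/-- `base d p < 2ᵏ` when `p < 2ᵏ`. [folklore] -/
theorem base_lt {k d p : ℕ} (hp : p < 2 ^ k) : base d p < 2 ^ k := (base_le d p).trans_lt hp

/-! ### Shifting the dimension -/

/-- `p / 2ᵈ⁺¹ = (p / 2) / 2ᵈ`. [folklore] -/
theorem div_two_pow_succ (d p : ℕ) : p / 2 ^ (d + 1) = p / 2 / 2 ^ d := by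
  rw [Nat.pow_succ', Nat.div_div_eq_div_mul]

/-- `flipBit (d+1) p = 2 · flipBit d (p / 2) + p % 2`. [folklore] -/
theorem flipBit_succ (d p : ℕ) : flipBit (d + 1) p = 2 * flipBit d (p / 2) + p % 2 := by
  have hp : 2 * (p / 2) + p % 2 = p := Nat.div_add_mod p 2
  have h2 : 2 ^ (d + 1) = 2 * 2 ^ d := Nat.pow_succ'
  unfold flipBit
  rw [div_two_pow_succ]
  split_ifs with h
  · have hle : 2 ^ d ≤ p / 2 := two_pow_le_of_odd h
    omega
  · omega

/-- `base (d+1) p = 2 · base d (p / 2) + p % 2`. [folklore] -/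
theorem base_succ (d p : ℕ) : base (d + 1) p = 2 * base d (p / 2) + p % 2 := by
  have hp : 2 * (p / 2) + p % 2 = p := Nat.div_add_mod p 2
  have h2 : 2 ^ (d + 1) = 2 * 2 ^ d := Nat.pow_succ'
  unfold base
  rw [div_two_pow_succ]
  split_ifs with h
  · have hle : 2 ^ d ≤ p / 2 := two_pow_le_of_odd h
    omega
  · omega

/-- `flipBit 0 p` toggles the last bit. [folklore] -/
theorem flipBit_zero (p : ℕ) : flipBit 0 p = if p % 2 = 1 then p - 1 else p + 1 := by
  simp [flipBit]

/-- `base 0 p = 2 · (p / 2)`. [folklore] -/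
theorem base_zero (p : ℕ) : base 0 p = 2 * (p / 2) := by
  have hp : 2 * (p / 2) + p % 2 = p := Nat.div_add_mod p 2
  simp only [base, Nat.pow_zero, Nat.div_one]
  have := Nat.mod_two_eq_zero_or_one p
  split_ifs with h <;> omega

/-- `flipBit 0 (2 i) = 2 i + 1`. [folklore] -/
theorem flipBit_zero_even (i : ℕ) : flipBit 0 (2 * i) = 2 * i + 1 := by
  rw [flipBit_zero]; simp

/-- `flipBit 0 (2 i + 1) = 2 i`. [folklore] -/
theorem flipBit_zero_odd (i : ℕ) : flipBit 0 (2 * i + 1) = 2 * i := by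
  rw [flipBit_zero]; simp

/-- `flipBit 0 p / 2 = p / 2`. [folklore] -/
theorem flipBit_zero_div_two (p : ℕ) : flipBit 0 p / 2 = p / 2 := by
  rw [flipBit_zero]
  have := Nat.mod_two_eq_zero_or_one p
  split_ifs with h <;> omega

/-- `flipBit 0 p % 2 = 1 - p % 2`. [folklore] -/
theorem flipBit_zero_mod_two (p : ℕ) : flipBit 0 p % 2 = 1 - p % 2 := by
  rw [flipBit_zero]
  have := Nat.mod_two_eq_zero_or_one p
  split_ifs with h <;> omega

/-! ### Layers and networks -/

/-- The position map of one layer of dimension `d` with switch setting `s`: position `p` moves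
to its partner iff the switch of its pair (read at `base d p`) is crossed. [cite: Waksman1968, §2] -/
def layer (d : ℕ) (s : ℕ → Bool) (p : ℕ) : ℕ := if s (base d p) then flipBit d p else p

/-- The position map of the network with dimension list `ds` (first layer first) and switch
settings `sw ℓ` for layer `ℓ`. [cite: Waksman1968, §2] -/
def run : List ℕ → (ℕ → ℕ → Bool) → ℕ → ℕ
  | [], _, p => p
  | d :: ds, sw, p => run ds (fun ℓ => sw (ℓ + 1)) (layer d (sw 0) p)

/-- The dimension list of the Beneš network on `2ᵏ` positions:
`[0, 1, …, k-1, k-1, …, 1, 0]`. [cite: Benes1964] -/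
def dims : ℕ → List ℕ
  | 0 => []
  | k + 1 => 0 :: ((dims k).map (· + 1) ++ [0])

/-- The empty network is the identity. [folklore] -/
@[simp] theorem run_nil (sw : ℕ → ℕ → Bool) (p : ℕ) : run [] sw p = p := rfl

/-- Unfolding the first layer of a network. [folklore] -/
@[simp] theorem run_cons (d : ℕ) (ds : List ℕ) (sw : ℕ → ℕ → Bool) (p : ℕ) :
    run (d :: ds) sw p = run ds (fun ℓ => sw (ℓ + 1)) (layer d (sw 0) p) := rfl

/-- A layer is an involution. [folklore] -/
@[simp] theorem layer_layer (d : ℕ) (s : ℕ → Bool) (p : ℕ) : layer d s (layer d s p) = p := by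
  unfold layer
  by_cases h : s (base d p) = true
  · rw [if_pos h, base_flipBit, if_pos h, flipBit_flipBit]
  · rw [if_neg h, if_neg h]

/-- A layer of dimension `d < k` preserves `[0, 2ᵏ)`. [folklore] -/
theorem layer_lt {k d p : ℕ} (hd : d < k) (hp : p < 2 ^ k) (s : ℕ → Bool) :
    layer d s p < 2 ^ k := by
  unfold layer; split_ifs
  · exact flipBit_lt hd hp
  · exact hp

/-- `run` over a concatenation: first network, then the second with re-indexed settings.
[folklore] -/
theorem run_append (ds ds' : List ℕ) (sw : ℕ → ℕ → Bool) (p : ℕ) :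
    run (ds ++ ds') sw p = run ds' (fun ℓ => sw (ds.length + ℓ)) (run ds sw p) := by
  induction ds generalizing sw p with
  | nil => simp
  | cons d ds ih =>
    simp only [List.cons_append, run_cons, ih, List.length_cons]
    congr 1
    funext ℓ
    congr 1
    omega

/-- `run` only reads the settings of its own layers. [folklore] -/
theorem run_congr {ds : List ℕ} {sw sw' : ℕ → ℕ → Bool} (h : ∀ ℓ < ds.length, sw ℓ = sw' ℓ) :
    ∀ p, run ds sw p = run ds sw' p := by
  induction ds generalizing sw sw' with
  | nil => intro p; rfl
  | cons d ds ih =>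
    intro p
    simp only [run_cons]
    rw [h 0 (by simp)]
    exact ih (fun ℓ hℓ => h (ℓ + 1) (by simp; omega)) _

/-- A network with dimensions `< k` preserves `[0, 2ᵏ)`. [folklore] -/
theorem run_lt {k : ℕ} {ds : List ℕ} (hds : ∀ d ∈ ds, d < k) (sw : ℕ → ℕ → Bool) {p : ℕ}
    (hp : p < 2 ^ k) : run ds sw p < 2 ^ k := by
  induction ds generalizing sw p with
  | nil => exact hp
  | cons d ds ih =>
    exact ih (fun d' hd' => hds d' (List.mem_cons_of_mem _ hd')) _
      (layer_lt (hds d (List.mem_cons_self ..)) hp _)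

/-- A network is injective on positions. [folklore] -/
theorem run_injective (ds : List ℕ) (sw : ℕ → ℕ → Bool) : Function.Injective (run ds sw) := by
  induction ds generalizing sw with
  | nil => intro p q h; exact h
  | cons d ds ih =>
    intro p q h
    simp only [run_cons] at h
    have h' := ih _ h
    have := congr_arg (layer d (sw 0)) h'
    rwa [layer_layer, layer_layer] at this

/-- A network with dimensions `< k` maps `[0, 2ᵏ)` ONTO itself. [folklore] -/
theorem exists_run_eq {k : ℕ} {ds : List ℕ} (hds : ∀ d ∈ ds, d < k) (sw : ℕ → ℕ → Bool) {q : ℕ}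
    (hq : q < 2 ^ k) : ∃ p < 2 ^ k, run ds sw p = q := by
  classical
  have h := Finset.surj_on_of_inj_on_of_card_le (s := Finset.range (2 ^ k))
    (t := Finset.range (2 ^ k)) (fun p _ => run ds sw p)
    (fun p hp => Finset.mem_range.2 (run_lt hds sw (Finset.mem_range.1 hp)))
    (fun p₁ p₂ _ _ h => run_injective ds sw h) le_rfl q (Finset.mem_range.2 hq)
  obtain ⟨p, hp, hpq⟩ := h
  exact ⟨p, Finset.mem_range.1 hp, hpq.symm⟩

/-- The dimensions of `dims k` are `< k`. [folklore] -/
theorem dims_lt : ∀ (k : ℕ), ∀ d ∈ dims k, d < k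
  | 0 => by simp [dims]
  | k + 1 => by
    intro d hd
    simp only [dims, List.mem_cons, List.mem_append, List.mem_map, List.not_mem_nil,
      or_false] at hd
    rcases hd with rfl | ⟨d', hd', rfl⟩ | rfl
    · exact Nat.succ_pos k
    · exact Nat.succ_lt_succ (dims_lt k d' hd')
    · exact Nat.succ_pos k

/-- `dims k` has `2k` layers. [folklore] -/
@[simp] theorem length_dims : ∀ k : ℕ, (dims k).length = 2 * k
  | 0 => rfl
  | k + 1 => by simp [dims, length_dims k]; ring

/-! ### Splitting a network with positive dimensions into its even and odd halves -/

/-- A layer of dimension `d + 1` acts on `p / 2` as a layer of dimension `d` with the settings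
read at the positions of the parity of `p`. [folklore] -/
theorem layer_succ (d : ℕ) (s : ℕ → Bool) (p : ℕ) :
    layer (d + 1) s p = 2 * layer d (fun q => s (2 * q + p % 2)) (p / 2) + p % 2 := by
  unfold layer
  rw [base_succ]
  split_ifs
  · exact flipBit_succ d p
  · exact (Nat.div_add_mod p 2).symm

/-- A network all of whose dimensions are shifted by one acts on `p / 2` as the unshifted
network with the settings read at the parity class of `p`, and keeps the parity. [folklore] -/
theorem run_map_succ (ds : List ℕ) (sw : ℕ → ℕ → Bool) (p : ℕ) :
    run (ds.map (· + 1)) sw p = 2 * run ds (fun ℓ q => sw ℓ (2 * q + p % 2)) (p / 2) + p % 2 := by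
  induction ds generalizing sw p with
  | nil => simpa using (Nat.div_add_mod p 2).symm
  | cons d ds ih =>
    simp only [List.map_cons, run_cons]
    rw [layer_succ, ih]
    have h1 : (2 * layer d (fun q => sw 0 (2 * q + p % 2)) (p / 2) + p % 2) % 2 = p % 2 := by
      rw [Nat.mul_add_mod]; exact Nat.mod_mod p 2
    have h2 : (2 * layer d (fun q => sw 0 (2 * q + p % 2)) (p / 2) + p % 2) / 2 =
        layer d (fun q => sw 0 (2 * q + p % 2)) (p / 2) := by
      rw [Nat.mul_add_div (by decide), Nat.div_eq_of_lt (Nat.mod_lt p (by decide)), Nat.add_zero]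
    rw [h1, h2]

/-! ### The routing lemma: two matchings admit a common bichromatic `2`-colouring -/

/-- **Routing lemma** (Waksman 1968, §2, the "looping algorithm"): if `a` and `b` are two
fixed-point-free involutions of a finite set `S`, there is a `2`-colouring `U` of `S` with
`U (a x) ≠ U x` and `U (b x) ≠ U x` for all `x ∈ S` (the union of two perfect matchings is a
disjoint union of even cycles). Proof by induction on `|S|`: remove a pair `{x, a x}` and mend
`b` by matching the two freed partners with each other. [cite: Waksman1968, §2] -/
theorem exists_twoColoring : ∀ (n : ℕ) (S : Finset ℕ) (a b : ℕ → ℕ), S.card = n →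
    (∀ x ∈ S, a x ∈ S ∧ a x ≠ x ∧ a (a x) = x) → (∀ x ∈ S, b x ∈ S ∧ b x ≠ x ∧ b (b x) = x) →
      ∃ U : ℕ → Bool, ∀ x ∈ S, U (a x) ≠ U x ∧ U (b x) ≠ U x := by
  intro n
  induction n using Nat.strong_induction_on with
  | _ n ih =>
  intro S a b hcard ha hb
  rcases S.eq_empty_or_nonempty with rfl | ⟨x, hx⟩
  · exact ⟨fun _ => true, fun x hx => absurd hx (Finset.notMem_empty x)⟩
  obtain ⟨hax, haxne, haax⟩ := ha x hx
  have hx'S : a x ∈ S.erase x := Finset.mem_erase.2 ⟨haxne, hax⟩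
  -- the smaller set
  let S' : Finset ℕ := (S.erase x).erase (a x)
  have hcard' : S'.card = n - 2 := by
    simp only [S']
    rw [Finset.card_erase_of_mem hx'S, Finset.card_erase_of_mem hx, hcard, Nat.sub_sub]
  have hlt : n - 2 < n := by
    have : 0 < n := by rw [← hcard]; exact Finset.card_pos.2 ⟨x, hx⟩
    omega
  have memS' : ∀ {w}, w ∈ S' ↔ w ∈ S ∧ w ≠ x ∧ w ≠ a x := by
    intro w; simp only [S', Finset.mem_erase]; tauto
  -- `a` restricts to `S'`
  have ha' : ∀ w ∈ S', a w ∈ S' ∧ a w ≠ w ∧ a (a w) = w := by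
    intro w hw
    obtain ⟨hwS, hwx, hwx'⟩ := memS'.1 hw
    obtain ⟨h1, h2, h3⟩ := ha w hwS
    refine ⟨memS'.2 ⟨h1, fun h => hwx' ?_, fun h => hwx ?_⟩, h2, h3⟩
    · rw [← h3, h]
    · rw [← h3, h, haax]
  obtain ⟨hyS, hyx, hbbx⟩ := hb x hx
  obtain ⟨hzS, hzx', hbbx'⟩ := hb (a x) hax
  have hne_not : ∀ {u v : Bool}, u ≠ v → (!u) ≠ (!v) := by decide
  have hnot_ne : ∀ u : Bool, (!u) ≠ u := by decide
  have hne_not' : ∀ u : Bool, u ≠ (!u) := by decide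
  by_cases hyx' : b x = a x
  · -- double edge: `b` swaps `x` and `a x`, hence restricts to `S'`
    have hzx : b (a x) = x := by rw [← hyx', hbbx]
    have hb' : ∀ w ∈ S', b w ∈ S' ∧ b w ≠ w ∧ b (b w) = w := by
      intro w hw
      obtain ⟨hwS, hwx, hwx'⟩ := memS'.1 hw
      obtain ⟨h1, h2, h3⟩ := hb w hwS
      refine ⟨memS'.2 ⟨h1, fun h => hwx' ?_, fun h => hwx ?_⟩, h2, h3⟩
      · rw [← h3, h, hyx']
      · rw [← h3, h, hzx]
    obtain ⟨U', hU'⟩ := ih (n - 2) hlt S' a b hcard' ha' hb'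
    let U : ℕ → Bool := fun w => if w = x then true else if w = a x then false else U' w
    have hUx : U x = true := by simp [U]
    have hUx' : U (a x) = false := by simp [U, haxne]
    have hUS' : ∀ w ∈ S', U w = U' w := by
      intro w hw; obtain ⟨-, h1, h2⟩ := memS'.1 hw; simp [U, h1, h2]
    refine ⟨U, fun w hwS => ?_⟩
    by_cases hwx : w = x
    · rw [hwx, hUx', hUx, hyx', hUx']; exact ⟨by decide, by decide⟩
    by_cases hwx'w : w = a x
    · rw [hwx'w, haax, hUx, hUx', hzx, hUx]; exact ⟨by decide, by decide⟩
    · have hw : w ∈ S' := memS'.2 ⟨hwS, hwx, hwx'w⟩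
      obtain ⟨h1, h2⟩ := hU' w hw
      rw [hUS' w hw, hUS' (a w) (ha' w hw).1, hUS' (b w) (hb' w hw).1]
      exact ⟨h1, h2⟩
  · -- generic case: mend `b` on `S'` by matching `b x` with `b (a x)`
    have hzx : b (a x) ≠ x := fun h => hyx' (by rw [← hbbx', h])
    have hyz : b x ≠ b (a x) := by
      intro h
      have : b (b x) = b (b (a x)) := by rw [h]
      rw [hbbx, hbbx'] at this
      exact haxne this.symm
    have hyS' : b x ∈ S' := memS'.2 ⟨hyS, hyx, hyx'⟩
    have hzS' : b (a x) ∈ S' := memS'.2 ⟨hzS, hzx, hzx'⟩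
    let b' : ℕ → ℕ := fun w => if w = b x then b (a x) else if w = b (a x) then b x else b w
    have hb'y : b' (b x) = b (a x) := by simp [b']
    have hb'z : b' (b (a x)) = b x := by simp [b', Ne.symm hyz]
    have hb'w : ∀ w, w ≠ b x → w ≠ b (a x) → b' w = b w := by
      intro w h1 h2; simp [b', h1, h2]
    have hb' : ∀ w ∈ S', b' w ∈ S' ∧ b' w ≠ w ∧ b' (b' w) = w := by
      intro w hw
      obtain ⟨hwS, hwx, hwx'⟩ := memS'.1 hw
      by_cases hwy : w = b x
      · rw [hwy, hb'y, hb'z]; exact ⟨hzS', Ne.symm hyz, rfl⟩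
      by_cases hwz : w = b (a x)
      · rw [hwz, hb'z, hb'y]; exact ⟨hyS', hyz, rfl⟩
      obtain ⟨h1, h2, h3⟩ := hb w hwS
      have hbwx : b w ≠ x := fun h => hwy (by rw [← h, h3])
      have hbwx' : b w ≠ a x := fun h => hwz (by rw [← h, h3])
      have hbwy : b w ≠ b x := fun h => hwx (by rw [← h3, h, hbbx])
      have hbwz : b w ≠ b (a x) := fun h => hwx' (by rw [← h3, h, hbbx'])
      rw [hb'w w hwy hwz, hb'w (b w) hbwy hbwz, h3]
      exact ⟨memS'.2 ⟨h1, hbwx, hbwx'⟩, h2, rfl⟩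
    obtain ⟨U', hU'⟩ := ih (n - 2) hlt S' a b' hcard' ha' hb'
    have hUyz : U' (b (a x)) ≠ U' (b x) := by have := (hU' (b x) hyS').2; rwa [hb'y] at this
    let U : ℕ → Bool :=
      fun w => if w = x then !U' (b x) else if w = a x then !U' (b (a x)) else U' w
    have hUx : U x = !U' (b x) := by simp [U]
    have hUx' : U (a x) = !U' (b (a x)) := by simp [U, haxne]
    have hUS' : ∀ w ∈ S', U w = U' w := by
      intro w hw; obtain ⟨-, h1, h2⟩ := memS'.1 hw; simp [U, h1, h2]
    refine ⟨U, fun w hwS => ?_⟩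
    by_cases hwx : w = x
    · rw [hwx, hUx', hUx, hUS' _ hyS']
      exact ⟨hne_not hUyz, hne_not' _⟩
    by_cases hwx'w : w = a x
    · rw [hwx'w, haax, hUx, hUx', hUS' _ hzS']
      exact ⟨hne_not (Ne.symm hUyz), hne_not' _⟩
    · have hw : w ∈ S' := memS'.2 ⟨hwS, hwx, hwx'w⟩
      obtain ⟨h1, h2⟩ := hU' w hw
      rw [hUS' w hw, hUS' (a w) (ha' w hw).1]
      refine ⟨h1, ?_⟩
      by_cases hwy : w = b x
      · rw [hwy, hbbx, hUx]; exact hnot_ne _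
      by_cases hwz : w = b (a x)
      · rw [hwz, hbbx', hUx']; exact hnot_ne _
      · have hbw : b w ∈ S' := by
          have := (hb' w hw).1; rwa [hb'w w hwy hwz] at this
        rw [hUS' (b w) hbw, ← hb'w w hwy hwz]
        exact h2

/-- The input/output stage: a layer of dimension `0` acts inside the pairs `{2m, 2m+1}`.
[folklore] -/
theorem layer_zero_apply (s : ℕ → Bool) (m b : ℕ) (hb : b < 2) :
    layer 0 s (2 * m + b) = 2 * m + (if s (2 * m) = true then 1 - b else b) := by
  unfold layer
  have hbase : base 0 (2 * m + b) = 2 * m := by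
    rw [base_zero, Nat.mul_add_div two_pos, Nat.div_eq_of_lt hb, Nat.add_zero]
  have hflip : flipBit 0 (2 * m + b) = 2 * m + (1 - b) := by
    rcases Nat.lt_succ_iff_lt_or_eq.1 hb with h | h
    · have h0 : b = 0 := by omega
      subst h0; rw [Nat.add_zero, flipBit_zero_even]
    · subst h; rw [flipBit_zero_odd]; rfl
  rw [hbase, hflip]
  split_ifs <;> rfl

/-! ### Rearrangeability -/

/-- In a pair `{2i, 2i+1}` coloured differently, the element of colour `u`. [folklore] -/
def pick (U : ℕ → Bool) (u : Bool) (i : ℕ) : ℕ := if U (2 * i) = u then 2 * i else 2 * i + 1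

/-- `pick U u i` lies in the pair `i`. [folklore] -/
theorem pick_div_two (U : ℕ → Bool) (u : Bool) (i : ℕ) : pick U u i / 2 = i := by
  unfold pick; split_ifs <;> omega

/-- `pick U u i < 2m` for `i < m`. [folklore] -/
theorem pick_lt {U : ℕ → Bool} {u : Bool} {i m : ℕ} (hi : i < m) : pick U u i < 2 * m := by
  unfold pick; split_ifs <;> omega

/-- If the pair `{2i, 2i+1}` is bichromatic, `pick U u i` has colour `u`. [folklore] -/
theorem color_pick {U : ℕ → Bool} {i : ℕ} (hU : U (2 * i + 1) ≠ U (2 * i)) (u : Bool) :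
    U (pick U u i) = u := by
  unfold pick
  split_ifs with h
  · exact h
  · revert hU h; cases U (2 * i + 1) <;> cases U (2 * i) <;> cases u <;> simp

/-- The element of colour `U p` in the pair of `p` is `p` itself. [folklore] -/
theorem pick_self {U : ℕ → Bool} {p : ℕ} (hU : U (flipBit 0 p) ≠ U p) : pick U (U p) (p / 2) = p := by
  have hp : 2 * (p / 2) + p % 2 = p := Nat.div_add_mod p 2
  unfold pick
  rcases Nat.mod_two_eq_zero_or_one p with h0 | h1
  · have he : 2 * (p / 2) = p := by omega
    rw [he, if_pos rfl]
  · have ho : 2 * (p / 2) = flipBit 0 p := by rw [flipBit_zero, if_pos h1]; omega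
    rw [ho, if_neg hU]; omega

/-- **Rearrangeability of the Beneš network** (Beneš 1964; Waksman 1968, §2): every bijection
`f` of `[0, 2ᵏ)` (with inverse `g`) is the position map of the network `dims k` under a
suitable switch setting. Induction on `k`: colour `[0, 2ᵏ⁺¹)` by the routing lemma for the
input pairs `{p, p ⊕ 1}` and the pulled-back output pairs `{g q, g (q ⊕ 1)}`; the input stage
sends every element to the half of its colour, each half realizes the induced bijection by
induction (`run_map_succ`), and the output stage restores the last bit. [cite: Waksman1968, §2] -/
theorem exists_switches : ∀ (k : ℕ) (f g : ℕ → ℕ),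
    (∀ p < 2 ^ k, f p < 2 ^ k ∧ g (f p) = p) → (∀ q < 2 ^ k, g q < 2 ^ k ∧ f (g q) = q) →
      ∃ sw : ℕ → ℕ → Bool, ∀ p < 2 ^ k, run (dims k) sw p = f p
  | 0, f, g, hf, _ => by
    refine ⟨fun _ _ => false, fun p hp => ?_⟩
    have hp0 : p = 0 := by simpa using hp
    have h1 := (hf p hp).1
    simp only [Nat.pow_zero, Nat.lt_one_iff] at h1
    subst hp0
    simp [dims, h1]
  | k + 1, f, g, hf, hg => by
    have hN : 2 ^ (k + 1) = 2 * 2 ^ k := Nat.pow_succ'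
    -- the routing colouring
    have ha : ∀ x ∈ Finset.range (2 ^ (k + 1)), flipBit 0 x ∈ Finset.range (2 ^ (k + 1)) ∧
        flipBit 0 x ≠ x ∧ flipBit 0 (flipBit 0 x) = x := fun x hx =>
      ⟨Finset.mem_range.2 (flipBit_lt (Nat.succ_pos k) (Finset.mem_range.1 hx)), flipBit_ne 0 x,
        flipBit_flipBit 0 x⟩
    have hb : ∀ x ∈ Finset.range (2 ^ (k + 1)),
        g (flipBit 0 (f x)) ∈ Finset.range (2 ^ (k + 1)) ∧ g (flipBit 0 (f x)) ≠ x ∧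
          g (flipBit 0 (f (g (flipBit 0 (f x))))) = x := by
      intro x hx
      have hx' := Finset.mem_range.1 hx
      obtain ⟨hfx, hgfx⟩ := hf x hx'
      have hfl : flipBit 0 (f x) < 2 ^ (k + 1) := flipBit_lt (Nat.succ_pos k) hfx
      obtain ⟨hgl, hfg⟩ := hg _ hfl
      refine ⟨Finset.mem_range.2 hgl, fun h => flipBit_ne 0 (f x) ?_, ?_⟩
      · rw [← hfg, h]
      · rw [hfg, flipBit_flipBit, hgfx]
    obtain ⟨U, hU⟩ := exists_twoColoring (2 ^ (k + 1)) (Finset.range (2 ^ (k + 1))) (flipBit 0)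
      (fun x => g (flipBit 0 (f x))) (Finset.card_range _) ha hb
    have hUa : ∀ x < 2 ^ (k + 1), U (flipBit 0 x) ≠ U x := fun x hx =>
      (hU x (Finset.mem_range.2 hx)).1
    have hUb : ∀ x < 2 ^ (k + 1), U (g (flipBit 0 (f x))) ≠ U x := fun x hx =>
      (hU x (Finset.mem_range.2 hx)).2
    have hUpair : ∀ i < 2 ^ k, U (2 * i + 1) ≠ U (2 * i) := fun i hi => by
      have := hUa (2 * i) (by omega); rwa [flipBit_zero_even] at this
    -- the induced bijections on the halves
    let fu : Bool → ℕ → ℕ := fun u i => f (pick U u i) / 2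
    let gu : Bool → ℕ → ℕ := fun u o => g (pick (fun q => U (g q)) u o) / 2
    have hUgpair : ∀ o < 2 ^ k, U (g (2 * o + 1)) ≠ U (g (2 * o)) := by
      intro o ho
      obtain ⟨hgo, hfgo⟩ := hg (2 * o) (by omega)
      have := hUb (g (2 * o)) hgo
      rwa [hfgo, flipBit_zero_even] at this
    have hfu : ∀ u, ∀ i < 2 ^ k, fu u i < 2 ^ k ∧ gu u (fu u i) = i := by
      intro u i hi
      have hxN : pick U u i < 2 ^ (k + 1) := by rw [hN]; exact pick_lt hi
      obtain ⟨hfx, hgfx⟩ := hf _ hxN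
      have hcol : U (pick U u i) = u := color_pick (hUpair i hi) u
      refine ⟨(Nat.div_lt_iff_lt_mul two_pos).2 (by rw [Nat.mul_comm, ← hN]; exact hfx), ?_⟩
      show g (pick (fun q => U (g q)) u (f (pick U u i) / 2)) / 2 = i
      have hop : pick (fun q => U (g q)) u (f (pick U u i) / 2) = f (pick U u i) := by
        have h := pick_self (U := fun q => U (g q)) (p := f (pick U u i))
          (by show U (g (flipBit 0 (f (pick U u i)))) ≠ U (g (f (pick U u i)))
              rw [hgfx]; exact hUb _ hxN)
        have hV : U (g (f (pick U u i))) = u := by rw [hgfx]; exact hcol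
        simpa only [hV] using h
      rw [hop, hgfx, pick_div_two]
    have hgu : ∀ u, ∀ o < 2 ^ k, gu u o < 2 ^ k ∧ fu u (gu u o) = o := by
      intro u o ho
      have hyN : pick (fun q => U (g q)) u o < 2 ^ (k + 1) := by rw [hN]; exact pick_lt ho
      obtain ⟨hgy, hfgy⟩ := hg _ hyN
      have hcol : U (g (pick (fun q => U (g q)) u o)) = u :=
        color_pick (U := fun q => U (g q)) (hUgpair o ho) u
      refine ⟨(Nat.div_lt_iff_lt_mul two_pos).2 (by rw [Nat.mul_comm, ← hN]; exact hgy), ?_⟩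
      show f (pick U u (g (pick (fun q => U (g q)) u o) / 2)) / 2 = o
      have hop : pick U u (g (pick (fun q => U (g q)) u o) / 2) =
          g (pick (fun q => U (g q)) u o) := by
        have h := pick_self (U := U) (p := g (pick (fun q => U (g q)) u o)) (hUa _ hgy)
        simpa only [hcol] using h
      rw [hop, hfgy, pick_div_two]
    obtain ⟨swF, hswF⟩ := exists_switches k (fu false) (gu false) (hfu false) (hgu false)
    obtain ⟨swT, hswT⟩ := exists_switches k (fu true) (gu true) (hfu true) (hgu true)
    -- the switch setting of the big network
    let SWmid : ℕ → ℕ → Bool := fun ℓ q => if q % 2 = 1 then swT ℓ (q / 2) else swF ℓ (q / 2)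
    let sw : ℕ → ℕ → Bool := fun ℓ q =>
      if ℓ = 0 then U q else if ℓ ≤ 2 * k then SWmid (ℓ - 1) q else U (g q)
    refine ⟨sw, fun p hp => ?_⟩
    have hpk : p / 2 < 2 ^ k := (Nat.div_lt_iff_lt_mul two_pos).2 (by rw [Nat.mul_comm, ← hN]; exact hp)
    have hsw0 : sw 0 = U := by funext q; simp [sw]
    -- stage 1: the input layer sends `p` to the half of its colour
    have hd : 2 * (p / 2) + p % 2 = p := Nat.div_add_mod p 2
    set bp : ℕ := if U p = true then 1 else 0 with hbp
    have hbp2 : bp < 2 := by rw [hbp]; split_ifs <;> decide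
    have hx1 : layer 0 U p = 2 * (p / 2) + bp := by
      conv_lhs => rw [← hd]
      rw [layer_zero_apply U (p / 2) (p % 2) (Nat.mod_lt p two_pos), hbp]
      congr 1
      rcases Nat.mod_two_eq_zero_or_one p with h0 | h1
      · have he : 2 * (p / 2) = p := by omega
        rw [h0, he]
      · have ho : 2 * (p / 2) = flipBit 0 p := by rw [flipBit_zero, if_pos h1]; omega
        rw [h1, ho]
        have hne := hUa p hp
        revert hne
        cases U (flipBit 0 p) <;> cases U p <;> simp
    have hx1mod : (2 * (p / 2) + bp) % 2 = bp := by rw [Nat.mul_add_mod, Nat.mod_eq_of_lt hbp2]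
    have hx1div : (2 * (p / 2) + bp) / 2 = p / 2 := by
      rw [Nat.mul_add_div two_pos, Nat.div_eq_of_lt hbp2, Nat.add_zero]
    -- stage 2: the two half-size networks
    have hmid : run ((dims k).map (· + 1)) (fun ℓ => sw (ℓ + 1)) (2 * (p / 2) + bp) =
        2 * (f p / 2) + bp := by
      rw [run_congr (sw' := SWmid) (fun ℓ hℓ => by
        funext q
        have h1 : ℓ + 1 ≠ 0 := Nat.succ_ne_zero ℓ
        have h2 : ℓ + 1 ≤ 2 * k := by rw [List.length_map, length_dims] at hℓ; omega
        simp [sw, h2])]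
      rw [run_map_succ, hx1mod, hx1div]
      have hsel : (fun ℓ q => SWmid ℓ (2 * q + bp)) = if U p = true then swT else swF := by
        funext ℓ q
        have hm : (2 * q + bp) % 2 = bp := by rw [Nat.mul_add_mod, Nat.mod_eq_of_lt hbp2]
        have hdv : (2 * q + bp) / 2 = q := by
          rw [Nat.mul_add_div two_pos, Nat.div_eq_of_lt hbp2, Nat.add_zero]
        simp only [SWmid, hm, hdv]
        rw [hbp]
        cases U p <;> simp
      rw [hsel]
      have hrun : run (dims k) (if U p = true then swT else swF) (p / 2) = f p / 2 := by
        cases hUp : U p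
        · simp only [Bool.false_eq_true, if_false]
          rw [hswF _ hpk]
          show f (pick U false (p / 2)) / 2 = f p / 2
          rw [← hUp, pick_self (hUa p hp)]
        · simp only [if_true]
          rw [hswT _ hpk]
          show f (pick U true (p / 2)) / 2 = f p / 2
          rw [← hUp, pick_self (hUa p hp)]
      rw [hrun]
    -- stage 3: the output layer restores the last bit
    obtain ⟨hfp, hgfp⟩ := hf p hp
    have hfd : 2 * (f p / 2) + f p % 2 = f p := Nat.div_add_mod (f p) 2
    have hout : layer 0 (fun q => U (g q)) (2 * (f p / 2) + bp) = f p := by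
      rw [layer_zero_apply _ (f p / 2) bp hbp2]
      conv_rhs => rw [← hfd]
      congr 1
      show (if U (g (2 * (f p / 2))) = true then 1 - bp else bp) = f p % 2
      rw [hbp]
      rcases Nat.mod_two_eq_zero_or_one (f p) with h0 | h1
      · have he : 2 * (f p / 2) = f p := by omega
        rw [h0, he, hgfp]
        cases U p <;> simp
      · have ho : 2 * (f p / 2) = flipBit 0 (f p) := by rw [flipBit_zero, if_pos h1]; omega
        rw [h1, ho]
        have hne := hUb p hp
        revert hne
        cases U (g (flipBit 0 (f p))) <;> cases U p <;> simp
    -- assembly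
    show run (0 :: ((dims k).map (· + 1) ++ [0])) sw p = f p
    rw [run_cons, hsw0, hx1, run_append, hmid]
    simp only [run_cons, run_nil, List.length_map, length_dims]
    have hlast : sw (2 * k + 0 + 1) = fun q => U (g q) := by
      funext q
      have h1 : 2 * k + 0 + 1 ≠ 0 := by omega
      have h2 : ¬ (2 * k + 0 + 1 ≤ 2 * k) := by omega
      simp only [sw, h1, h2, if_false]
    rw [hlast, hout]

end Benes

end Literature.Computability.Complexity
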